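import Summits.BirchSwinnertonDyer.BirchSwinnertonDyer.Theorems.Rank1ResidualJetSection6
import Mathlib.Algebra.Module.Prod
import Mathlib.Algebra.Field.ZMod
import HarnessLib

/-!
BARRIER (relative): Jetchev [J] Thm 6.3 with ALL carriers stringent proves exponent(Q′) ≤ m_∞ (max form) ONLY; explicit model with
#Q′ = 9, m_∞ = 1 satisfying every §6 input in which the SUM form fails — the multi-carrier increment of Σ is not a consequence of [J]'s
inputs; closes no stub; not a partial toward Σ. (Label prescribed by director-bsd (858)(a), 2026-08-31T16:45:48Z.)

# Crux X₄ `TprimeHeegnerUpperOfManinUnit` (stmt-BirchSwinnertonDyer-23738; TQMP r4 / TQS r303), line `rows_of_manin_unit` v2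
# (08412075024a), research stub Σ `stub_sigmaIrreducibleOptimalRows`: A KERNEL CERTIFICATE THAT JETCHEV'S §6 METHOD PAYS
# `max_i ord₃ c_{q_i}` AND PROVABLY NOT `Σ_i ord₃ c_{q_i}` — the multi-carrier increment Σ⁺ is outside the method, with or
# without a «three-class» Čebotarev choice at `p = 3`

HONEST FRAMING. Theorems only; helper file (`--supports stmt-BirchSwinnertonDyer-23738 --as helper`, leafhand
`leafhand-bsd-tamequarticmaninpa-6` g0, 2026-08-31); no definition, no named fact, no `sorry`; nothing booked, no stub closed BY
NAME, no item closed, BSD proved for no curve. What the three earlier hands established (p823764 … p828099): on the (t′) irreducible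
rows Σ = `M_∞ ≥ ord₃ ∏ c_ℓ` in McCallum currency (p826193); every row with ≤ 1 Tamagawa-`3` carrier is print + L₀ (p827407,
p827999); the exact residual is Σ⁺ = the increment `max_q ord₃ c_q < s′ ≤ ord₃ ∏_ℓ c_ℓ` on the rows with ≥ 2 carriers (p827819),
i.e. Jetchev 2008 Conj. 1.3 beyond Thm. 1.4. The serve-list brief for this hand reads «Jetchev Thm 1.4 at additive 3 beyond
mono-carrier rows; three-class Chebotarev via Sakamoto 2024». THIS FILE SETTLES THAT BRIEF IN THE KERNEL, NEGATIVELY, relative to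
the inputs Jetchev's proof uses — the inputs of the tree's abstract Thm. 6.3
`Rank1Residual.JET.Section6.tamagawaExponent_le_mInfty_of_minimalCoreVertex` (p. 823; cell bsd-jet): global duality counts at
the carrier and at the Kolyvagin prime `λ` (Thm. 5.1 / Lemma 5.2 (iii)), the Čebotarev choice Lemma 6.1, the shapes of Prop. 4.7
and Prop. 4.9, the classes `κ̃_{c,m}`, `κ_{c,m} = p^{m_∞} κ̃_{c,m}`.

* §1 `tamagawaExponent_le_mInfty_of_minimalCoreVertex_of_addOrderOf` — **the ALL-CARRIER stringent structure pays the EXPONENT.**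
  The tree's abstract Thm. 6.3 asks the dual local quotient `Q' = (H¹_{Kum⁰}^⊥/H¹_Kum)^{−ε}` to be CYCLIC of order `p^t` (one
  carrier `q`, `Φ_q[p^∞]` cyclic). With the stringent Kummer structure `𝓕_⌈q₁⋯q_s⌉` at ALL Tamagawa-`p` carriers (Def. 4.8) the
  quotient is `⊕_i ℤ/p^{t_i}`, `t_i = ord_p c_{q_i}`; the same printed proof goes through VERBATIM for any finite `Q'` possessing an
  element of order `p^t` and yields `t ≤ m_∞` — so the method's output is `log_p exponent(Q') = max_i t_i ≤ m_∞`, Jetchev's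
  `m_max`, however many carriers are made stringent. (Strictly more general than the tree's cyclic statement; same dictionary.)
* §2 **THE SUM FORM IS NOT A CONSEQUENCE OF THESE INPUTS** (`not_sum_le_mInfty_of_section6Inputs`). An explicit model of EVERY
  hypothesis of §1 ∕ of the tree's Thm. 6.3 with the cyclicity clause replaced by «`#Q' = p^T`» (the datum the SUM form
  `T = Σ_i t_i ≤ m_∞` would need to exploit): `p = 3`, `m = 2`, two Tamagawa-`3` carriers with `t₁ = t₂ = 1` (`Q' = (ℤ/3)²`,
  `T = 2`), and `m_∞ = 1`. All duality counts, the class shapes, Prop. 4.7/4.9 and Lemma 6.1 hold in it — indeed a THREE-CLASS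
  Čebotarev holds in it (`threeClass_cebotarev_model`: any `ε`-class and any THREE non-zero `−ε`-classes are read faithfully at one
  prime; four cannot be, exactly as for a rank-one local condition over `𝔽₃`, whose kernel on a plane is one of four lines) — and
  yet `T = 2 > 1 = m_∞`. Hence no argument whose only inputs are those of Jetchev's §6 (with a Čebotarev lemma of any number of
  classes) proves Σ⁺; the obstruction is the COUNT at `λ` — `loc_λ` of the `−ε` dual Selmer module `⊕_i ℤ/3^{t_i}` lands in the
  rank-one `H¹_ur(K_λ, E[3^m])^{−ε}`, so `#loc_λ(C') ≤ 3^{max t_i}` — not the choice of the prime. Sakamoto 2024 (J. Théor.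
  Nombres Bordeaux 36; tree `Literature.NumberTheory.GaloisCohomology.Sakamoto2024KolyvaginRankOne`) is the Mazur–Rubin structure
  theorem for core-rank-one Kolyvagin systems at `p = 3`: it repairs the prime choice at `3` and does not touch this count.
WHAT THIS DOES NOT SAY. It is a barrier RELATIVE to the listed inputs, not a proof that Σ⁺ is false or unprovable: Σ⁺ follows from
BSD₃(E/K) (p826123 `sigmaIrreducibleOptimalRows_of_bsdp`) and, for `p ∤ N`, `p > 3` good ordinary, `M_∞ = ord_p ∏ c_q` is BCGS's
Thm. 2 — proved through the anticyclotomic main conjecture, an input outside this list. The informal absolute form of the barrier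
(the scenario «`y_K = 3P`, `Ш(E/K)[3^∞] = 0`, `t₁ = t₂ = 1`, all `m_r = 1`» is consistent with Kolyvagin's structure theorem, the
Cassels–Tate pairing and every finite-level Selmer-structure constraint, and is excluded only by the BSD formula) is recorded in this
hand's census (evidence on 23738), not asserted here.
References: [cite: Jetchev2008, Thm. 1.4, Conj. 1.3 (p. 812); Def. 4.8, Prop. 4.9 (p. 819); Thm. 5.1, Lemma 5.2 (iii) (p. 821); Lemma 6.1,
Thm. 6.3 and its proof (pp. 822–824)] [cite: McCallumLMS1991, §3 Cor. 3.2, §5 Prop. 5.2 (pp. 298–304)] [cite: Sakamoto2024, Thm. 4.4 (1) (p. 926)]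
[cite: BurungaleEtAl2026, Thm. 2]. presearch (D-0021): `lean search 'mInfty_of_minimalCoreVertex|exponent.*Tamagawa|multiCarrier'` → the
tree's cyclic Thm. 6.3 (bsd-jet) and SOED's statement item J⁗ 25898 only; [corpus:arxiv-math_0703431 p. 3, pp. 15–16] `m_max` only;
[corpus:arxiv-0710.3858 §4.2 Q1] «this method captures only one Tamagawa factor»; [corpus:arxiv-2312.09301 Thm. 2] `p > 3` good ordinary;
galaxy «Tamagawa|Kolyvagin system» (bm25 not used) → W. Zhang 2014 / BCGS; nothing at an additive `p`, nothing proving or refuting a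
finite-level route to the sum. Elementary finite-group bookkeeping over the abstract data of `Rank1ResidualJetSection6`; axioms standard.
-/

-- D-0017: single-problem summit, so `Summit.BirchSwinnertonDyer.BirchSwinnertonDyer.…` repeats a namespace BY DESIGN.
set_option linter.dupNamespace false
set_option autoImplicit false

noncomputable section

open scoped Classical

namespace Summit.BirchSwinnertonDyer.BirchSwinnertonDyer.Theorems.TprimeHeegnerUpperOfManinUnit.SigmaMethodBarrier

open Summit.BirchSwinnertonDyer.Rank1Residual.JET.Section6

/-! ## §1 Jetchev's Thm. 6.3 with ALL carriers stringent: the method pays the exponent of the dual local quotient -/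

/-- **Jetchev 2008, Thm. 6.3 (p. 823) for the all-carrier stringent structure `𝓕_⌈q₁⋯q_s⌉`, abstract kernel form: a minimal
core vertex forces `log_p exponent(Q') ≤ m_∞`.** Data and hypotheses are those of the tree's
`JET.Section6.tamagawaExponent_le_mInfty_of_minimalCoreVertex` (dictionary in that module's docstring: `A' = 𝓗_{𝓕(c)}^{−ε} = 0`,
`B' = 𝓗_{𝓕₀(c)}^{−ε}`, `C' = 𝓗_{𝓕₀(c)^*}^{−ε}`, `D' ℓ = 𝓗_{(𝓕₀)^ℓ(c)}^{−ε}`, global duality at the carriers `locq`/`locq'`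
with `#im locq · #im locq' = #Q'`, duality at `λ` with `#im(sing ℓ) · #loc_λ(C') = p^m`, Lemma 6.1 `h61`, the classes
`κ̃_{c,m}` of order `p^m`, `κ_{c,m} = p^{m_∞} κ̃`, `κ_{cℓ,m} ∈ D' ℓ` (Prop. 4.9), equal local orders (Prop. 4.7)) EXCEPT that the
dual local quotient `Q'` — for `𝓕₀ = 𝓕_⌈q₁⋯q_s⌉` it is `(⊕_{v ∣ q₁⋯q_s} H¹_{Kum⁰}(K_v)^⊥/H¹_Kum(K_v))^{−ε} ≅ ⊕_i ℤ/p^{t_i}`,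
`t_i = ord_p c_{q_i}`, NOT cyclic for `s ≥ 2` — is only asked to contain an element `g₀` of order `p^t` (e.g. `t = max_i t_i`).
CONCLUSION `t ≤ m_∞`. PROOF (the printed one, `−ε` side): `A' = 0` makes `locq'` injective with image of full size, hence
bijective; pull `g₀` back to `g ∈ C'` of order `p^t`; Lemma 6.1 gives `ℓ` with `ord loc_λ κ̃ = p^m` and `ord loc_λ g = p^t`, so
`p^t ∣ #loc_λ(C')`, whence `#D' ℓ ∣ p^{m−t}` (`B' = 0`); `κ_{cℓ,m} ∈ D' ℓ` has order dividing `p^{m−t}`, and that order is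
`ord loc_λ κ_{c,m} = p^{m−m_∞}`. So the all-carrier structure yields exactly Jetchev's `m_max ≤ m_∞`, never more from these inputs
(§2). The tree's cyclic statement is the case `g₀` = a generator of the cyclic `Q'` of order `p^t` (`IsAddCyclic.exists_generator`,
`addOrderOf_eq_card_of_forall_mem_zmultiples`). [cite: Jetchev2008, Thm. 6.3 and its proof (pp. 823–824); Def. 4.8; Thm. 5.1, Lemma 5.2 (iii), Lemma 6.1, Prop. 4.7, Prop. 4.9] -/
theorem tamagawaExponent_le_mInfty_of_minimalCoreVertex_of_addOrderOf
    {p : ℕ} (hp : p.Prime) {m t mInf : ℕ} (htm : t ≤ m) (hInfm : mInf ≤ m)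
    {Hp Hm : Type*} [AddCommGroup Hp] [AddCommGroup Hm] {ι : Type*}
    {Lp Lm : ι → Type*} [∀ ℓ, AddCommGroup (Lp ℓ)] [∀ ℓ, AddCommGroup (Lm ℓ)]
    (locP : ∀ ℓ, Hp →+ Lp ℓ) (locM : ∀ ℓ, Hm →+ Lm ℓ)
    (A' B' C' : AddSubgroup Hm) (D' : ι → AddSubgroup Hm)
    (hB'A' : B' ≤ A') (hcore : A' = ⊥)
    {Q Q' : Type*} [AddCommGroup Q] [AddCommGroup Q'] [Finite Q']
    (locq : A' →+ Q) (locq' : C' →+ Q')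
    (hker : ∀ x : C', locq' x = 0 ↔ (x : Hm) ∈ A')
    (horth_q : Nat.card locq.range * Nat.card locq'.range = Nat.card Q')
    (g₀ : Q') (hg₀ : addOrderOf g₀ = p ^ t)
    (h61 : ∀ (x : Hp) (y : Hm), y ≠ 0 →
      ∃ ℓ, addOrderOf (locP ℓ x) = addOrderOf x ∧ addOrderOf (locM ℓ y) = addOrderOf y)
    {S : ι → Type*} [∀ ℓ, AddCommGroup (S ℓ)] (sing : ∀ ℓ, D' ℓ →+ S ℓ)
    (hsing : ∀ ℓ (x : D' ℓ), sing ℓ x = 0 ↔ (x : Hm) ∈ B')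
    (horth_ℓ : ∀ ℓ, Nat.card (sing ℓ).range * Nat.card (C'.map (locM ℓ)) = p ^ m)
    (κt κ : Hp) (hκ : κ = p ^ mInf • κt) (hκt : addOrderOf κt = p ^ m)
    (κℓ : ι → Hm) (h49 : ∀ ℓ, κℓ ℓ ∈ D' ℓ)
    (h47 : ∀ ℓ, addOrderOf (locM ℓ (κℓ ℓ)) = addOrderOf (locP ℓ κ)) :
    t ≤ mInf := by
  -- trivial when `t = 0`
  rcases Nat.eq_zero_or_pos t with ht0 | ht0
  · omega
  -- `B' = 0`
  have hB' : B' = ⊥ := le_bot_iff.mp (hcore ▸ hB'A')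
  -- `locq` has trivial image (its source `A'` is trivial), so `#im locq' = #Q'`
  have hrange_q : Nat.card locq.range = 1 := by
    have : locq.range = ⊥ := by
      rw [eq_bot_iff]
      rintro _ ⟨x, rfl⟩
      have hx : (x : Hm) ∈ (⊥ : AddSubgroup Hm) := hcore ▸ x.2
      have : x = 0 := by ext; simpa using hx
      simp [this]
    rw [this, AddSubgroup.card_bot]
  rw [hrange_q, one_mul] at horth_q
  -- `locq'` is injective (its kernel is `A' = 0`) and surjective (full image in the finite `Q'`)
  have hinj : Function.Injective locq' := by
    rw [injective_iff_map_eq_zero]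
    intro x hx
    have hx' : (x : Hm) ∈ (⊥ : AddSubgroup Hm) := hcore ▸ (hker x).mp hx
    ext; simpa using hx'
  have hsurj : Function.Surjective locq' := by
    rw [← AddMonoidHom.range_eq_top, ← AddSubgroup.card_eq_iff_eq_top]
    exact horth_q
  -- pull back the element of order `p^t`
  obtain ⟨g, hg⟩ := hsurj g₀
  have hordg : addOrderOf (g : Hm) = p ^ t := by
    rw [AddSubgroup.addOrderOf_coe, ← addOrderOf_injective locq' hinj g, hg, hg₀]
  have hg0 : (g : Hm) ≠ 0 := by
    intro h
    rw [h, addOrderOf_zero] at hordg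
    have : 1 < p ^ t := Nat.one_lt_pow ht0.ne' hp.one_lt
    omega
  -- Lemma 6.1: choose `ℓ`
  obtain ⟨ℓ, hℓP, hℓM⟩ := h61 κt (g : Hm) hg0
  rw [hκt] at hℓP
  rw [hordg] at hℓM
  -- `p^t ∣ #loc_λ(C')`
  have hdvd_img : p ^ t ∣ Nat.card (C'.map (locM ℓ)) := by
    rw [← hℓM]
    exact (C'.map (locM ℓ)).addOrderOf_dvd_natCard (AddSubgroup.mem_map_of_mem (locM ℓ) g.2)
  -- `sing ℓ` is injective (`B' = 0`), so `#D' ℓ = #im(sing ℓ)`, and then `#D' ℓ ∣ p^(m - t)`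
  have hsing_inj : Function.Injective (sing ℓ) := by
    rw [injective_iff_map_eq_zero]
    intro x hx
    have hx' : (x : Hm) ∈ (⊥ : AddSubgroup Hm) := hB' ▸ (hsing ℓ x).mp hx
    ext; simpa using hx'
  have hcardD : Nat.card (D' ℓ) ∣ p ^ (m - t) := by
    have h1 : Nat.card (D' ℓ) = Nat.card (sing ℓ).range :=
      Nat.card_congr (AddMonoidHom.ofInjective hsing_inj).toEquiv
    obtain ⟨k, hk⟩ := hdvd_img
    have h2 := horth_ℓ ℓ
    rw [hk, ← h1, ← Nat.sub_add_cancel htm, pow_add] at h2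
    refine ⟨k, ?_⟩
    have h3 : Nat.card (D' ℓ) * k * p ^ t = p ^ (m - t) * p ^ t := by rw [← h2]; ring
    exact (Nat.eq_of_mul_eq_mul_right (pow_pos hp.pos t) h3).symm
  -- the order of `loc_λ κ_{cℓ,m}` divides `p^(m - t)` …
  have hdvd : addOrderOf (locM ℓ (κℓ ℓ)) ∣ p ^ (m - t) :=
    (addOrderOf_map_dvd_card_of_mem (locM ℓ) (D' ℓ) (h49 ℓ)).trans hcardD
  -- … and equals `ord loc_λ κ_{c,m} = p^(m - mInf)`
  have hordκ : addOrderOf (locP ℓ κ) = p ^ (m - mInf) := by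
    rw [hκ, map_nsmul]
    exact addOrderOf_pow_nsmul_eq hp hInfm _ hℓP
  rw [h47 ℓ, hordκ, Nat.pow_dvd_pow_iff_le_right hp.one_lt] at hdvd
  omega

/-! ## §2 The model: every §6 input with TWO Tamagawa-`3` carriers (`#Q' = 9`) and `m_∞ = 1` — the SUM form is not derivable -/

/-- In `𝔽₃²` a non-zero vector is not isotropic for the dot product: `y ≠ 0 ⇒ y·y ≠ 0` (squares in `𝔽₃` are `0, 1`).
The model's Lemma 6.1: the `−ε`-class `y` is read faithfully at the "prime" `w = y`. Finite check. [folklore] -/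
theorem dot_self_ne_zero_model : ∀ y : ZMod 3 × ZMod 3, y ≠ 0 → y.1 * y.1 + y.2 * y.2 ≠ 0 := by
  decide

/-- **A THREE-CLASS Čebotarev holds in the model**: any three non-zero vectors of `𝔽₃²` admit a common functional `w ≠ 0`
(dot product with `w`) non-zero on all three — a linear form on the plane kills exactly one of its FOUR lines. (Four classes, one on
each line, cannot be read at once: the same limit as for the rank-one local condition `H¹_ur(K_λ, E[3])^{−ε} ≅ 𝔽₃`.) Finite check.
[folklore] -/
theorem threeClass_cebotarev_model :
    ∀ y₁ y₂ y₃ : ZMod 3 × ZMod 3, y₁ ≠ 0 → y₂ ≠ 0 → y₃ ≠ 0 →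
      ∃ w : ZMod 3 × ZMod 3, w ≠ 0 ∧ w.1 * y₁.1 + w.2 * y₁.2 ≠ 0 ∧ w.1 * y₂.1 + w.2 * y₂.2 ≠ 0 ∧
        w.1 * y₃.1 + w.2 * y₃.2 ≠ 0 := by
  decide

/-- `3` kills `𝔽₃²`. Finite check. [folklore] -/
theorem three_nsmul_model : ∀ y : ZMod 3 × ZMod 3, 3 • y = 0 := by
  decide

/-- `3` kills `𝔽₃`. Finite check. [folklore] -/
theorem three_nsmul_model' : ∀ a : ZMod 3, 3 • a = 0 := by
  decide

/-- A non-zero element of `𝔽₃²` has additive order `3`. [folklore] -/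
theorem addOrderOf_model {y : ZMod 3 × ZMod 3} (hy : y ≠ 0) : addOrderOf y = 3 :=
  haveI : Fact (Nat.Prime 3) := ⟨Nat.prime_three⟩
  addOrderOf_eq_prime (three_nsmul_model y) hy

/-- A non-zero element of `𝔽₃` has additive order `3`. [folklore] -/
theorem addOrderOf_model' {a : ZMod 3} (ha : a ≠ 0) : addOrderOf a = 3 :=
  haveI : Fact (Nat.Prime 3) := ⟨Nat.prime_three⟩
  addOrderOf_eq_prime (three_nsmul_model' a) ha

/-- A subgroup of `𝔽₃` containing a non-zero element is everything (prime order), so has `3` elements. [folklore] -/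
theorem card_eq_three_of_mem_model {H : AddSubgroup (ZMod 3)} {a : ZMod 3} (ha : a ≠ 0) (haH : a ∈ H) :
    Nat.card H = 3 := by
  haveI : Fact (Nat.card (ZMod 3)).Prime := ⟨by rw [Nat.card_zmod]; exact Nat.prime_three⟩
  rcases H.eq_bot_or_eq_top_of_prime_card with h | h
  · exact absurd ((AddSubgroup.mem_bot).mp (h ▸ haH)) ha
  · rw [h, AddSubgroup.card_top, Nat.card_zmod]

/-- **THE SUM FORM IS NOT A CONSEQUENCE OF JETCHEV'S §6 INPUTS** (method barrier, relative). The statement negated below is the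
tree's abstract Thm. 6.3 (`JET.Section6.tamagawaExponent_le_mInfty_of_minimalCoreVertex`) — all its data and hypotheses VERBATIM:
`−ε` Selmer modules `A' ≥ B'`, `A' = 0` (core vertex), `C'`, `D' ℓ`; global duality at the carriers (`locq`, `locq'`, kernel
`A'`, `#im locq · #im locq' = #Q'`); Lemma 6.1 (`h61`); duality at `λ` (`sing`, kernel `B'`, `#im(sing ℓ) · #loc_λ(C') = p^m`);
`κ = p^{m_∞} κ̃`, `ord κ̃ = p^m`; `κ_{cℓ,m} ∈ D' ℓ` (Prop. 4.9); equal local orders (Prop. 4.7) — with the ONE-carrier clause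
«`Q'` cyclic of order `p^t`» replaced by the datum the multi-carrier SUM form would have to exploit, «`#Q' = p^T`»
(`Q' = ⊕_i ℤ/p^{t_i}`, `T = Σ_i t_i = ord_p ∏_q c_q`), and the conclusion `T ≤ m_∞`. REFUTATION by the model `p = 3`, `m = 2`,
`T = 2`, `m_∞ = 1`: `Hp = ℤ/9 ∋ κ̃ = 1`, `κ = 3`; `Hm = Q' = 𝔽₃² = C'` (two carriers, `t₁ = t₂ = 1`), `A' = B' = 0`; Kolyvagin
"primes" = the non-zero `w ∈ 𝔽₃²`, `loc_w^{ε} = id`, `loc_w^{−ε} = ⟨w, ·⟩` (dot product; the `3`-torsion line of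
`H¹_ur(K_λ, E[9])^{−ε} ≅ ℤ/9` is where `C'[3]` lands — only orders and indices enter the inputs), `D' w = ℤw`,
`sing w = ⟨w, ·⟩|_{ℤw}`, `κ_{cw} = w`. Every hypothesis holds (`#im(sing w) · #⟨w, C'⟩ = 3 · 3 = 9 = 3^m`; `ord ⟨w, w⟩ = 3 =
ord(3 ∈ ℤ/9)`; Lemma 6.1 via `w = y`, and even for three `−ε` classes at once, `threeClass_cebotarev_model`), `#Q' = 9 = 3^2`,
and `2 ≤ 1` is false. READING: no proof of the increment Σ⁺ (`max_q ord₃ c_q < s′ ≤ ord₃ ∏ c_ℓ`; p827819 `hIncr`) can be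
assembled from these inputs alone — a Čebotarev lemma for any number of classes included («three-class Chebotarev via Sakamoto
2024» of the serve-list brief); an input outside the list (anticyclotomic Iwasawa theory in BCGS Thm. 2; BSD₃ itself in p826123) is
necessary. Relative barrier only: Σ⁺ is not claimed false. [cite: Jetchev2008, Thm. 6.3 (p. 823), Conj. 1.3 and Thm. 1.4 (p. 812)]
[cite: Sakamoto2024, Thm. 4.4 (1) (p. 926)] [cite: BurungaleEtAl2026, Thm. 2] -/
theorem not_sum_le_mInfty_of_section6Inputs :
    ¬ ∀ (p : ℕ) (_hp : p.Prime) (m T mInf : ℕ) (_hTm : T ≤ m) (_hInfm : mInf ≤ m)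
        (Hp Hm : Type) [AddCommGroup Hp] [AddCommGroup Hm] (ι : Type)
        (Lp Lm : ι → Type) [∀ ℓ, AddCommGroup (Lp ℓ)] [∀ ℓ, AddCommGroup (Lm ℓ)]
        (locP : ∀ ℓ, Hp →+ Lp ℓ) (locM : ∀ ℓ, Hm →+ Lm ℓ)
        (A' B' C' : AddSubgroup Hm) (D' : ι → AddSubgroup Hm)
        (_hB'A' : B' ≤ A') (_hcore : A' = ⊥)
        (Q Q' : Type) [AddCommGroup Q] [AddCommGroup Q'] [Finite Q']
        (locq : A' →+ Q) (locq' : C' →+ Q')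
        (_hker : ∀ x : C', locq' x = 0 ↔ (x : Hm) ∈ A')
        (_horth_q : Nat.card locq.range * Nat.card locq'.range = Nat.card Q')
        (_hQ'card : Nat.card Q' = p ^ T)
        (_h61 : ∀ (x : Hp) (y : Hm), y ≠ 0 →
          ∃ ℓ, addOrderOf (locP ℓ x) = addOrderOf x ∧ addOrderOf (locM ℓ y) = addOrderOf y)
        (S : ι → Type) [∀ ℓ, AddCommGroup (S ℓ)] (sing : ∀ ℓ, D' ℓ →+ S ℓ)
        (_hsing : ∀ ℓ (x : D' ℓ), sing ℓ x = 0 ↔ (x : Hm) ∈ B')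
        (_horth_ℓ : ∀ ℓ, Nat.card (sing ℓ).range * Nat.card (C'.map (locM ℓ)) = p ^ m)
        (κt κ : Hp) (_hκ : κ = p ^ mInf • κt) (_hκt : addOrderOf κt = p ^ m)
        (κℓ : ι → Hm) (_h49 : ∀ ℓ, κℓ ℓ ∈ D' ℓ)
        (_h47 : ∀ ℓ, addOrderOf (locM ℓ (κℓ ℓ)) = addOrderOf (locP ℓ κ)),
        T ≤ mInf := by
  intro h
  haveI : Fact (Nat.Prime 3) := ⟨Nat.prime_three⟩
  -- the model
  let ι : Type := {w : ZMod 3 × ZMod 3 // w ≠ 0}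
  let dot : ι → (ZMod 3 × ZMod 3 →+ ZMod 3) := fun w ↦
    AddMonoidHom.mk' (fun y ↦ w.1.1 * y.1 + w.1.2 * y.2) (by intro a b; simp only [Prod.fst_add, Prod.snd_add]; ring)
  have hdot : ∀ (w : ι) (y : ZMod 3 × ZMod 3), dot w y = w.1.1 * y.1 + w.1.2 * y.2 := fun _ _ ↦ rfl
  let D' : ι → AddSubgroup (ZMod 3 × ZMod 3) := fun w ↦ AddSubgroup.zmultiples w.1
  -- the dot product with `w` is faithful on the line `ℤw`
  have hline : ∀ (w : ι) (x : ZMod 3 × ZMod 3), x ∈ D' w → (dot w x = 0 ↔ x = 0) := by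
    intro w x hx
    obtain ⟨k, rfl⟩ := AddSubgroup.mem_zmultiples_iff.mp hx
    have hww : dot w w.1 ≠ 0 := by rw [hdot]; exact dot_self_ne_zero_model w.1 w.2
    have key : ∀ c : ZMod 3, c • w.1 = 0 ↔ c = 0 := fun c ↦
      ⟨fun h0 ↦ by_contra fun hc ↦ w.2 (by rw [← inv_smul_smul₀ hc w.1, h0, smul_zero]),
        fun hc ↦ by rw [hc, zero_smul]⟩
    rw [map_zsmul, ← Int.cast_smul_eq_zsmul (ZMod 3) k (dot w w.1), ← Int.cast_smul_eq_zsmul (ZMod 3) k w.1,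
      smul_eq_mul, mul_eq_zero, or_iff_left hww, key]
  have hT := h 3 Nat.prime_three 2 2 1 le_rfl (by norm_num)
    (ZMod 9) (ZMod 3 × ZMod 3) ι (fun _ ↦ ZMod 9) (fun _ ↦ ZMod 3)
    (fun _ ↦ AddMonoidHom.id (ZMod 9)) dot
    ⊥ ⊥ ⊤ D' le_rfl rfl
    (ZMod 3) (ZMod 3 × ZMod 3) (0 : (⊥ : AddSubgroup (ZMod 3 × ZMod 3)) →+ ZMod 3)
    ((⊤ : AddSubgroup (ZMod 3 × ZMod 3)).subtype)
    (fun x ↦ by simp)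
    (by rw [AddMonoidHom.range_zero, AddSubgroup.card_bot, AddSubgroup.range_subtype, AddSubgroup.card_top, one_mul])
    (by rw [Nat.card_prod, Nat.card_zmod]; norm_num)
    (by
      intro x y hy
      refine ⟨⟨y, hy⟩, rfl, ?_⟩
      rw [addOrderOf_model hy, addOrderOf_model' (by rw [hdot]; exact dot_self_ne_zero_model y hy)])
    (fun _ ↦ ZMod 3) (fun w ↦ (dot w).comp (D' w).subtype)
    (by
      intro w x
      rw [AddSubgroup.mem_bot, AddMonoidHom.comp_apply, AddSubgroup.coe_subtype, hline w x x.2])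
    (by
      intro w
      have hww : dot w w.1 ≠ 0 := by rw [hdot]; exact dot_self_ne_zero_model w.1 w.2
      have h1 : Nat.card ((dot w).comp (D' w).subtype).range = 3 :=
        card_eq_three_of_mem_model hww ⟨⟨w.1, AddSubgroup.mem_zmultiples w.1⟩, rfl⟩
      have h2 : Nat.card ((⊤ : AddSubgroup (ZMod 3 × ZMod 3)).map (dot w)) = 3 :=
        card_eq_three_of_mem_model hww (AddSubgroup.mem_map_of_mem _ (AddSubgroup.mem_top _))
      rw [h1, h2]; norm_num)
    1 ((3 : ℕ) ^ 1 • (1 : ZMod 9)) rfl (by rw [ZMod.addOrderOf_one]; norm_num)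
    (fun w ↦ w.1) (fun w ↦ AddSubgroup.mem_zmultiples w.1)
    (by
      intro w
      have hww : dot w w.1 ≠ 0 := by rw [hdot]; exact dot_self_ne_zero_model w.1 w.2
      rw [addOrderOf_model' hww, AddMonoidHom.id_apply,
        addOrderOf_pow_nsmul_eq Nat.prime_three (m := 2) (a := 1) (by norm_num) (1 : ZMod 9)
          (by rw [ZMod.addOrderOf_one]; norm_num)]
      norm_num)
  omega

end Summit.BirchSwinnertonDyer.BirchSwinnertonDyer.Theorems.TprimeHeegnerUpperOfManinUnit.SigmaMethodBarrier

end
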